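/-
Copyright (c) 2026 the pub-hodgecm-mathlib formalisation cell (harness21).  Prover seat hodgecm-mathlib-K2E3-p20 (g5), Track B «K2-LIT» ∕ h413
(`stmt-HodgeConjecture-24833`), line `K2_E3_EllipticInputs`, unit U12 §L, kernel road «RICHARDSON» for (L-B_GL) at `N = 3` (road owner K2E3-p11 (g4)),
leaf (LBGL-3J) «Borel slice density of 𝔤𝔩₃» (hand K2E3-p17 (g6), census (D60) 2840745a), brick A (A1): THE LIE TWIST ON `𝔫₃` AT A REGULAR DIAGONAL.  2026-09-04.
-/
import Summits.HodgeConjecture.HodgeConjecture.Theorems.K2E3GL3BorelUnipotentHaar    -- ★ p857423 (K2E3-p11 g4): coordinates `e` on `N₃`, `coord_inv`, Haar = `C • e_* vol`, `map_coordShear`, `map_coordScale`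
import HarnessLib

/-!
# K2_E3 road (h413), §L — (LBGL-3J) brick A (A1): the Lie twist `u ↦ Ad(u) s` of `N₃` at a regular diagonal `s ∈ 𝔤𝔩₃(F)`

Cell `pub/hodgecm-mathlib` (D-0151), Track B, seat K2E3-p20 (g5); leaf hand K2E3-p17 (g6) (CENSUS-SBflatLie-N3 §1 (i), §3 brick A «HAND WANTED #1»), road owner
K2E3-p11 (g4), dealer K2E3-plan (g3).  `--supports stmt-HodgeConjecture-24833 --as helper`; THEOREMS ONLY (no definition ∕ instance ∕ notation ∕ named fact ∕ `sorry`);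
never imports `Cruxes/…/Lines`.  COUNT-NEUTRAL ((LBGL-3J) ∕ (LBGL-ge3) ∕ (L-B_GL) stay OPEN).

THE MATHEMATICS (Harish-Chandra's Lemma «`n ↦ Ad(n)H − H` is a measure-scaling bijection of `𝔫`» for the Borel of `𝔤𝔩₃`).  `F` non-archimedean local, `N₃ ≤ GL₃(F)` upper
unitriangular with Haar measure `μ_N`, `dx` an additive Haar measure on `F`, `s = diag(d₀, d₁, d₂)` with `dᵢ` pairwise distinct.  In the coordinates
`e(x, y, z) = [[1,x,z],[0,1,y],[0,0,1]]` of ★ p857423: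
  **`Ad(e(x,y,z)) s = s + [[0, (d₁−d₀)x, (d₂−d₀)z + (d₀−d₁)xy], [0, 0, (d₂−d₁)y], [0, 0, 0]]`** (§1 `conj_coord_diagonal`),
i.e. `u ↦ Ad(u)s − s` is, in coordinates, the shear `(x,y,z) ↦ (x, y, z + σxy)` (`σ = (d₀−d₁)∕(d₂−d₀)`) followed by the diagonal scaling by
`(d₁−d₀, d₂−d₁, d₂−d₀)` — so with `μ_N = C₀ · e_* vol` (★), ★ `map_coordShear` and ★ `map_coordScale`:
  **`lintegral_conj_diagonal_eq` (A1): `∃ C ∈ (0, ∞)` (depending on `μ_N`, `dx` only) with, for every regular diagonal `d` and every Borel `φ ≥ 0`,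
  `∫⁻_{N₃} φ(u s u⁻¹) dμ_N = C · ‖(d₀−d₁)(d₀−d₂)(d₁−d₂)‖_F⁻¹ · ∫⁻_{r ∈ F³} φ(s + [[0,r₀,r₁],[0,0,r₂],[0,0,0]]) d(dx^{⊗3})`**
(the chart `r ↦ ((r₀, r₂), r₁)` of `(F × F) × F` costs one more Haar-uniqueness constant, `d`-free).  This is the Lie twin of ★ p857423 §3
`exists_homeomorph_conj_diagonal_eq_mul` (group twist `u t u⁻¹ = ψ(u) t`), with the SAME shear constant; consumer: brick H `exists_splitCartanSliceDensity` (K2E3-p17 (g6)).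
[HarishChandra1999AdmissibleDistributions, Lemma 7.8, §7]; [HarishChandra1970, Part I §2 Lemma 3]; [Rogawski1990, §4.13 p. 70]; [BernsteinZelevinsky1976, §1.19].

HONEST LABEL: HC_CM is proved only modulo the 7 printed citations (2 remaining named inputs: hLiu418 = stmt-HodgeConjecture-24832, h413 = stmt-HodgeConjecture-24833)
until rung 0 closes; count-neutral helper.
-/

set_option autoImplicit false
set_option linter.dupNamespace false   -- `Summit.HodgeConjecture.HodgeConjecture.…` (D-0017 nested layout; lakefile exemption for Summits)

noncomputable section

open MeasureTheory MeasureTheory.Measure Filter Topology TopologicalSpace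
open scoped MatrixGroups NNReal ENNReal
open Literature.NumberTheory.Automorphic
open Literature.NumberTheory.GaloisRepresentations Literature.NumberTheory.GaloisRepresentations.IsNonarchimedeanLocalField
open Summit.HodgeConjecture.HodgeConjecture.Cruxes.H413.K2E3GL3BorelUnipotentHaar

namespace Summit.HodgeConjecture.HodgeConjecture.Cruxes.H413.K2E3GL3LieUnipotentTwist

/-! ## §1  `Ad(e(x,y,z)) diag(d) = diag(d) + [[0, (d₁−d₀)x, (d₂−d₀)z + (d₀−d₁)xy], [0, 0, (d₂−d₁)y], 0]` -/

section Algebra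

variable {R : Type*} [CommRing R] [TopologicalSpace R] [IsTopologicalRing R]

omit [IsTopologicalRing R] in
/-- **The Lie twist in coordinates**: `e(x,y,z) · diag(d) · e(x,y,z)⁻¹ = diag(d) + [[0, (d₁−d₀)x, (d₂−d₀)z + (d₀−d₁)xy], [0, 0, (d₂−d₁)y], [0, 0, 0]]`
(★ `coord_inv`: `e(x,y,z)⁻¹ = e(−x, −y, xy − z)`). [cite: HarishChandra1970, Part I §2, Lemma 3] [cite: BernsteinZelevinsky1976, §1.19] -/
theorem conj_coord_diagonal (e : (R × R) × R ≃ₜ ↥(unipotentRadicalGL R (id : Fin 3 → Fin 3)))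
    (he : ∀ p : (R × R) × R, (((e p : ↥(unipotentRadicalGL R (id : Fin 3 → Fin 3))) : GL (Fin 3) R) : Matrix (Fin 3) (Fin 3) R) =
      !![1, p.1.1, p.2; 0, 1, p.1.2; 0, 0, 1]) (d : Fin 3 → R) (p : (R × R) × R) :
    (((e p : ↥(unipotentRadicalGL R (id : Fin 3 → Fin 3))) : GL (Fin 3) R) : Matrix (Fin 3) (Fin 3) R) * Matrix.diagonal d *
        ((((e p : ↥(unipotentRadicalGL R (id : Fin 3 → Fin 3))) : GL (Fin 3) R)⁻¹ : GL (Fin 3) R) : Matrix (Fin 3) (Fin 3) R) =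
      Matrix.diagonal d + !![0, (d 1 - d 0) * p.1.1, (d 2 - d 0) * p.2 + (d 0 - d 1) * p.1.1 * p.1.2; 0, 0, (d 2 - d 1) * p.1.2; 0, 0, 0] := by
  have hinv : ((((e p : ↥(unipotentRadicalGL R (id : Fin 3 → Fin 3))) : GL (Fin 3) R)⁻¹ : GL (Fin 3) R) : Matrix (Fin 3) (Fin 3) R) =
      !![1, -p.1.1, p.1.1 * p.1.2 - p.2; 0, 1, -p.1.2; 0, 0, 1] := by
    rw [← Subgroup.coe_inv, coord_inv e he p, he]
  have hdiag : (Matrix.diagonal d : Matrix (Fin 3) (Fin 3) R) = !![d 0, 0, 0; 0, d 1, 0; 0, 0, d 2] := by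
    ext i j
    fin_cases i <;> fin_cases j <;> simp
  rw [hinv, he, hdiag]
  ext i j
  fin_cases i <;> fin_cases j <;> simp [Matrix.mul_apply, Fin.sum_univ_three] <;> ring

end Algebra

/-! ## §2  The twist integral: shear, scaling, and the `F³` chart -/

section Twist

variable (F : Type*) [Field F] [ValuativeRel F] [TopologicalSpace F] [IsNonarchimedeanLocalField F]
  [MeasurableSpace F] [BorelSpace F] [MeasurableSpace (GL (Fin 3) F)] [BorelSpace (GL (Fin 3) F)]
  [MeasurableSpace (Matrix (Fin 3) (Fin 3) F)] [BorelSpace (Matrix (Fin 3) (Fin 3) F)]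

omit [MeasurableSpace (GL (Fin 3) F)] [BorelSpace (GL (Fin 3) F)] [MeasurableSpace (Matrix (Fin 3) (Fin 3) F)] [BorelSpace (Matrix (Fin 3) (Fin 3) F)] in
/-- The chart `r ↦ ((r₀, r₂), r₁) : F³ → (F × F) × F` carries `dx^{⊗3}` to a positive multiple of `vol = (dx ⊗ dx) ⊗ dx` (both are additive Haar measures).
[cite: BernsteinZelevinsky1976, §1.19] -/
theorem exists_map_pi_chart_eq_smul (dx : Measure F) [dx.IsAddHaarMeasure] :
    ∃ c : ℝ≥0, c ≠ 0 ∧ (Measure.pi fun _ : Fin 3 => dx).map (fun r : Fin 3 → F => ((r 0, r 2), r 1)) = c • (dx.prod dx).prod dx := by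
  haveI : T2Space F := (isLocalField F).toT2Space
  haveI : LocallyCompactSpace F := (isLocalField F).toLocallyCompactSpace
  haveI : SecondCountableTopology F := secondCountableTopology_localField F
  haveI : IsTopologicalRing F := inferInstance
  haveI : BorelSpace (F × F) := Prod.borelSpace
  haveI : BorelSpace ((F × F) × F) := Prod.borelSpace
  haveI : SFinite dx := inferInstance
  -- the chart as a continuous additive equivalence
  let E : (Fin 3 → F) ≃+ (F × F) × F :=
    { toFun := fun r => ((r 0, r 2), r 1)
      invFun := fun p => ![p.1.1, p.2, p.1.2]
      left_inv := fun r => by funext i; fin_cases i <;> rfl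
      right_inv := fun p => rfl
      map_add' := fun r r' => rfl }
  have hE : Continuous E := ((continuous_apply 0).prodMk (continuous_apply 2)).prodMk (continuous_apply 1)
  have hEs : Continuous E.symm := continuous_pi fun i => by
    fin_cases i
    · exact continuous_fst.comp continuous_fst
    · exact continuous_snd
    · exact continuous_snd.comp continuous_fst
  haveI : ((Measure.pi fun _ : Fin 3 => dx).map E).IsAddHaarMeasure := AddEquiv.isAddHaarMeasure_map _ E hE hEs
  refine ⟨addHaarScalarFactor ((Measure.pi fun _ : Fin 3 => dx).map E) ((dx.prod dx).prod dx),
    (addHaarScalarFactor_pos_of_isAddHaarMeasure _ _).ne', ?_⟩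
  exact isAddLeftInvariant_eq_smul _ _

/-- **(A1) THE LIE TWIST OF `N₃` AT A REGULAR DIAGONAL, AS AN INTEGRAL FORMULA.**  `μ_N` a Haar measure on the upper unitriangular `N₃ ≤ GL₃(F)`, `dx` an additive
Haar measure on `F`.  There is ONE `C ∈ (0, ∞)` such that for every `d : Fin 3 → F` with pairwise distinct entries and every Borel `φ : 𝔤𝔩₃(F) → [0, ∞]`:
**`∫⁻_{N₃} φ(u · diag d · u⁻¹) dμ_N = C · ‖(d₀−d₁)(d₀−d₂)(d₁−d₂)‖_F⁻¹ · ∫⁻_{F³} φ(diag d + [[0,r₀,r₁],[0,0,r₂],[0,0,0]]) d(dx^{⊗3})`** — `u ↦ Ad(u)s − s` maps `μ_N` to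
`‖Πᵢ₍<ⱼ(dᵢ−dⱼ)‖⁻¹` times the Lebesgue measure of `𝔫₃` (shear then scaling in the coordinates of ★ p857423). [cite: HarishChandra1999AdmissibleDistributions, Lemma 7.8, §7]
[cite: HarishChandra1970, Part I §2, Lemma 3] [cite: Rogawski1990, §4.13 p. 70] -/
theorem lintegral_conj_diagonal_eq (μN : Measure ↥(unipotentRadicalGL F (id : Fin 3 → Fin 3))) [IsHaarMeasure μN] (dx : Measure F) [dx.IsAddHaarMeasure] :
    ∃ C : ℝ≥0∞, C ≠ 0 ∧ C ≠ ∞ ∧ ∀ (d : Fin 3 → F), d 0 ≠ d 1 → d 0 ≠ d 2 → d 1 ≠ d 2 →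
      ∀ φ : Matrix (Fin 3) (Fin 3) F → ℝ≥0∞, Measurable φ →
        ∫⁻ u : ↥(unipotentRadicalGL F (id : Fin 3 → Fin 3)),
            φ (((u : GL (Fin 3) F) : Matrix (Fin 3) (Fin 3) F) * Matrix.diagonal d * (((u : GL (Fin 3) F)⁻¹ : GL (Fin 3) F) : Matrix (Fin 3) (Fin 3) F)) ∂μN =
          C * ((normAbs F ((d 0 - d 1) * (d 0 - d 2) * (d 1 - d 2)))⁻¹ : ℝ≥0) *
            ∫⁻ r : Fin 3 → F, φ (Matrix.diagonal d + !![0, r 0, r 1; 0, 0, r 2; 0, 0, 0]) ∂(Measure.pi fun _ : Fin 3 => dx) := by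
  haveI : T2Space F := (isLocalField F).toT2Space
  haveI : LocallyCompactSpace F := (isLocalField F).toLocallyCompactSpace
  haveI : SecondCountableTopology F := secondCountableTopology_localField F
  haveI : IsTopologicalRing F := inferInstance
  haveI : BorelSpace ↥(unipotentRadicalGL F (id : Fin 3 → Fin 3)) := Subtype.borelSpace _
  haveI : BorelSpace (F × F) := Prod.borelSpace
  haveI : BorelSpace ((F × F) × F) := Prod.borelSpace
  haveI : SFinite dx := inferInstance
  -- coordinates and the two Haar-uniqueness constants
  obtain ⟨e, he⟩ := exists_coordHomeomorph (R := F)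
  obtain ⟨C₀, hC₀, hμN⟩ := exists_haar_eq_smul_map_coord e he dx μN
  obtain ⟨c₃, hc₃, hchart⟩ := exists_map_pi_chart_eq_smul F dx
  refine ⟨(C₀ : ℝ≥0∞) * ((c₃⁻¹ : ℝ≥0) : ℝ≥0∞), mul_ne_zero (ENNReal.coe_ne_zero.2 hC₀) (ENNReal.coe_ne_zero.2 (inv_ne_zero hc₃)),
    ENNReal.mul_ne_top ENNReal.coe_ne_top ENNReal.coe_ne_top, fun d h01 h02 h12 φ hφ => ?_⟩
  have h10 : d 1 - d 0 ≠ 0 := sub_ne_zero.2 (Ne.symm h01)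
  have h21 : d 2 - d 1 ≠ 0 := sub_ne_zero.2 (Ne.symm h12)
  have h20 : d 2 - d 0 ≠ 0 := sub_ne_zero.2 (Ne.symm h02)
  -- the affine target map `q ↦ diag d + N(q)` and its measurability
  set G : (F × F) × F → ℝ≥0∞ := fun q => φ (Matrix.diagonal d + !![0, q.1.1, q.2; 0, 0, q.1.2; 0, 0, 0]) with hG
  have hNc : Continuous fun q : (F × F) × F => (Matrix.diagonal d + !![0, q.1.1, q.2; 0, 0, q.1.2; 0, 0, 0] : Matrix (Fin 3) (Fin 3) F) := by
    refine continuous_const.add (continuous_matrix fun i j => ?_)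
    fin_cases i <;> fin_cases j <;> simp <;> fun_prop
  have hGm : Measurable G := hφ.comp hNc.measurable
  -- the substitution `T = D ∘ S` (shear, then scaling)
  set T : (F × F) × F → (F × F) × F := fun p => (((d 1 - d 0) * p.1.1, (d 2 - d 1) * p.1.2), (d 2 - d 0) * (p.2 + (d 0 - d 1) / (d 2 - d 0) * p.1.1 * p.1.2)) with hT
  have hTm : Measurable T := by fun_prop
  have hTsplit : T = (fun p : (F × F) × F => (((d 1 - d 0) * p.1.1, (d 2 - d 1) * p.1.2), (d 2 - d 0) * p.2)) ∘
      fun p : (F × F) × F => (p.1, p.2 + (d 0 - d 1) / (d 2 - d 0) * p.1.1 * p.1.2) := rfl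
  have hmapT : ((dx.prod dx).prod dx).map T =
      ((normAbs F (d 1 - d 0)⁻¹ * normAbs F (d 2 - d 1)⁻¹ * normAbs F (d 2 - d 0)⁻¹ : ℝ≥0) : ℝ≥0∞) • (dx.prod dx).prod dx := by
    rw [hTsplit, ← Measure.map_map (by fun_prop) (by fun_prop), map_coordShear dx _, map_coordScale dx h10 h21 h20]
  -- STEP 1: `μN = C₀ • e_* vol`, and the pointwise identity `Ad(e p) s = diag d + N(T p)`
  have hstep1 : ∫⁻ u : ↥(unipotentRadicalGL F (id : Fin 3 → Fin 3)),
      φ (((u : GL (Fin 3) F) : Matrix (Fin 3) (Fin 3) F) * Matrix.diagonal d * (((u : GL (Fin 3) F)⁻¹ : GL (Fin 3) F) : Matrix (Fin 3) (Fin 3) F)) ∂μN =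
      (C₀ : ℝ≥0∞) * ∫⁻ p : (F × F) × F, G (T p) ∂((dx.prod dx).prod dx) := by
    have hmeas : Measurable fun u : ↥(unipotentRadicalGL F (id : Fin 3 → Fin 3)) =>
        φ (((u : GL (Fin 3) F) : Matrix (Fin 3) (Fin 3) F) * Matrix.diagonal d * (((u : GL (Fin 3) F)⁻¹ : GL (Fin 3) F) : Matrix (Fin 3) (Fin 3) F)) :=
      hφ.comp (((Units.continuous_val.comp continuous_subtype_val).mul continuous_const).mul
        (Units.continuous_coe_inv.comp continuous_subtype_val)).measurable
    rw [hμN, lintegral_smul_measure, lintegral_map hmeas e.continuous.measurable]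
    congr 1
    refine lintegral_congr fun p => ?_
    rw [conj_coord_diagonal e he d p, hG, hT]
    congr 2
    ext i j
    fin_cases i <;> fin_cases j <;> simp
    field_simp
  -- STEP 2: substitute `q = T p`
  have hstep2 : ∫⁻ p : (F × F) × F, G (T p) ∂((dx.prod dx).prod dx) =
      ((normAbs F (d 1 - d 0)⁻¹ * normAbs F (d 2 - d 1)⁻¹ * normAbs F (d 2 - d 0)⁻¹ : ℝ≥0) : ℝ≥0∞) * ∫⁻ q, G q ∂((dx.prod dx).prod dx) := by
    rw [← lintegral_map hGm hTm, hmapT, lintegral_smul_measure, smul_eq_mul]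
  -- STEP 3: the chart `F³ → (F × F) × F`
  have hstep3 : ∫⁻ r : Fin 3 → F, φ (Matrix.diagonal d + !![0, r 0, r 1; 0, 0, r 2; 0, 0, 0]) ∂(Measure.pi fun _ : Fin 3 => dx) =
      (c₃ : ℝ≥0∞) * ∫⁻ q, G q ∂((dx.prod dx).prod dx) := by
    have hch : Measurable fun r : Fin 3 → F => ((r 0, r 2), r 1) := by fun_prop
    have h1 : ∫⁻ r : Fin 3 → F, φ (Matrix.diagonal d + !![0, r 0, r 1; 0, 0, r 2; 0, 0, 0]) ∂(Measure.pi fun _ : Fin 3 => dx) =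
        ∫⁻ r : Fin 3 → F, G ((r 0, r 2), r 1) ∂(Measure.pi fun _ : Fin 3 => dx) := lintegral_congr fun r => rfl
    rw [h1, ← lintegral_map hGm hch, hchart, lintegral_smul_measure, ENNReal.smul_def, smul_eq_mul]
  -- the norm factor
  have hnorm : (normAbs F (d 1 - d 0)⁻¹ * normAbs F (d 2 - d 1)⁻¹ * normAbs F (d 2 - d 0)⁻¹ : ℝ≥0) =
      (normAbs F ((d 0 - d 1) * (d 0 - d 2) * (d 1 - d 2)))⁻¹ := by
    rw [map_inv₀, map_inv₀, map_inv₀, ← neg_sub (d 0) (d 1), ← neg_sub (d 1) (d 2), ← neg_sub (d 0) (d 2), normAbs_neg, normAbs_neg, normAbs_neg,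
      map_mul, map_mul, mul_inv, mul_inv]
    ring
  -- assemble
  have hc₃' : (c₃ : ℝ≥0∞) ≠ 0 := ENNReal.coe_ne_zero.2 hc₃
  have hG_eq : ∫⁻ q, G q ∂((dx.prod dx).prod dx) =
      ((c₃⁻¹ : ℝ≥0) : ℝ≥0∞) * ∫⁻ r : Fin 3 → F, φ (Matrix.diagonal d + !![0, r 0, r 1; 0, 0, r 2; 0, 0, 0]) ∂(Measure.pi fun _ : Fin 3 => dx) := by
    rw [hstep3, ← mul_assoc, ENNReal.coe_inv hc₃, ENNReal.inv_mul_cancel hc₃' ENNReal.coe_ne_top, one_mul]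
  rw [hstep1, hstep2, hG_eq, hnorm]
  ring

end Twist

end Summit.HodgeConjecture.HodgeConjecture.Cruxes.H413.K2E3GL3LieUnipotentTwist

end
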